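import Literature.NumberTheory.LFunctions.RiemannXiPrimitive
import Literature.NumberTheory.LFunctions.SelbergMollifierProofs
import Literature.Analysis.SpecialFunctions.GammaStirlingUniform
import Literature.Analysis.SpecialFunctions.DigammaStirlingSecondOrder
import HarnessLib

/-!
# Lagarias–Montague 2011, Lemma 3.3 (2): the far-field size of `ξ(s)` — discharged

Topic `Literature/NumberTheory/LFunctions`; companion of `RiemannXiPrimitive.lean` (the sibling
`RiemannXiPrimitiveProofs.lean` discharges Lemma 3.3 (1), the strip bound), which vendors
Lemma 3.3 (2) of J. C. Lagarias, D. Montague, *The integral of the Riemann ξ-function*, Comment.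
Math. Univ. St. Pauli 60 (2011) 143–169 (arXiv:1106.4348) as the named fact
`Literature.NumberTheory.LFunctions.norm_riemannXi_two_sided_LM`:
for `σ ≥ 2` and all real `t`,
`F(σ,t)(1 − C₂(1/|σ+it| + 2^{−σ})) ≤ |ξ(σ+it)| ≤ F(σ,t)(1 + C₃(1/|σ+it| + 2^{−σ}))` with the size
model `F(σ,t) = √π (2πe)^{−σ/2} (σ²+t²)^{(σ+3)/4} exp(−(t/2) arctan(t/σ))` (their (3.6)).
This file PROVES it (`norm_riemannXi_two_sided_LM_holds`, with `C₂ = C₃ = 8`), following the printed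
proof (p. 9 of the arXiv version) step by step:

* `|s(s−1)| = |s|² |1 − 1/s|`, `1 − 1/|s| ≤ |1 − 1/s| ≤ 1 + 1/|s|`;
* `|ζ(s)| = 1 + O(2^{−σ})`: the tree's
  `Literature.NumberTheory.LFunctions.SelbergMollifier.norm_riemannZeta_sub_one_le`,
  `|ζ(s) − 1| ≤ 4 · 2^{−σ}` for `σ ≥ 2` (Dirichlet series);
* `|π^{−s/2}| = π^{−σ/2}` and `ξ(s) = ½ s(s−1) π^{−s/2} Γ(s/2) ζ(s)`
  (`LagariasMontague.norm_riemannXi_eq`);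
* Stirling: `|Γ(s/2)| = exp((σ/2 − ½) log|s/2| − (t/2) arctan(t/σ) − σ/2 + ½ log 2π + θ)` with
  `|θ| ≤ (1/12)(4/|s|² + π/|s|) ≤ 1/(2|s|)` — the uniform complex Stirling formula
  `Literature.Analysis.SpecialFunctions.GammaStirling.abs_log_norm_Gamma_sub_le` of
  `Literature/Analysis/SpecialFunctions/GammaStirlingUniform.lean` at `w = s/2`
  (`LagariasMontague.abs_log_norm_Gamma_half_sub_le`);
* the size model is exactly the product of the main terms
  (`LagariasMontague.sizeModel_eq_stirling`), so `|ξ(s)| = F(σ,t) · |1 − 1/s| · e^θ · |ζ(s)|`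
  (`LagariasMontague.norm_riemannXi_eq_sizeModel_mul`), and the three factors are
  `1 + O(1/|s| + 2^{−σ})` (`LagariasMontague.triple_product_bounds`).

Everything here is proved; no definitions, no named facts.

## References

* J. C. Lagarias, D. Montague, *The integral of the Riemann ξ-function*, Comment. Math. Univ.
  St. Pauli 60 (2011), no. 1-2, 143–169; arXiv:1106.4348 — Lemma 3.3 (2), eq. (3.6), proof on p. 9.
  [key `LagariasMontague2011`]
* E. C. Titchmarsh, *The Theory of the Riemann Zeta-Function*, 2nd ed., §2.1 (the factorisation
  of `ξ`).
-/

noncomputable section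

open Complex Real Set Filter Topology MeasureTheory Finset

open Literature.Analysis.SpecialFunctions.GammaStirling (abs_log_norm_Gamma_sub_le)
open Literature.Analysis.SpecialFunctions.Complex (arg_eq_arctan_of_re_pos)
open Literature.NumberTheory.LFunctions.SelbergMollifier (norm_riemannZeta_sub_one_le)

namespace Literature.NumberTheory.LFunctions

namespace LagariasMontague

/-! ### The size model is the Stirling main term -/

/-- **The size model `F(σ,t)` of Lagarias–Montague is the Stirling main term**: for `σ > 0` and
`s = σ + it`,
`F(σ, t) = (‖s‖²/2) · π^{−σ/2} · exp((σ/2 − ½) log(‖s‖/2) − (t/2) arctan(t/σ) − σ/2 + ½ log 2π)`,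
the last factor being `exp Re[(w − ½) Log w − w] · √(2π)` at `w = s/2`.
[cite: LagariasMontague2011, eq. (3.6) and proof of Lemma 3.3 (2)] -/
theorem sizeModel_eq_stirling {σ : ℝ} (hσ : 0 < σ) (t : ℝ) :
    LagariasMontague.sizeModel σ t =
      ‖(σ : ℂ) + t * I‖ ^ 2 / 2 * π ^ (-(σ / 2)) *
        Real.exp ((σ / 2 - 1 / 2) * Real.log (‖(σ : ℂ) + t * I‖ / 2) -
          (t / 2) * Real.arctan (t / σ) - σ / 2 + Real.log (2 * π) / 2) := by
  set r : ℝ := ‖(σ : ℂ) + t * I‖ with hr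
  have hr2 : r ^ 2 = σ ^ 2 + t ^ 2 := by
    rw [hr, Complex.sq_norm, Complex.normSq_apply]; simp; ring
  have hrpos : 0 < r := by
    rw [hr]
    refine norm_pos_iff.2 fun h ↦ ?_
    have := congrArg Complex.re h
    simp at this
    linarith
  unfold LagariasMontague.sizeModel
  have e1 : Real.sqrt π = Real.exp (Real.log π / 2) := by
    rw [← Real.log_sqrt Real.pi_pos.le, Real.exp_log (Real.sqrt_pos.2 Real.pi_pos)]
  have e2 : (2 * π * Real.exp 1) ^ (-(σ / 2)) =
      Real.exp ((Real.log 2 + Real.log π + 1) * (-(σ / 2))) := by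
    rw [Real.rpow_def_of_pos (by positivity), Real.log_mul (by positivity) (Real.exp_pos 1).ne',
      Real.log_mul two_ne_zero Real.pi_pos.ne', Real.log_exp]
  have e3 : (σ ^ 2 + t ^ 2) ^ ((σ + 3) / 4) = Real.exp (2 * Real.log r * ((σ + 3) / 4)) := by
    rw [← hr2, Real.rpow_def_of_pos (by positivity), Real.log_pow]
    norm_num
  have e4 : r ^ 2 / 2 * π ^ (-(σ / 2)) =
      Real.exp (2 * Real.log r - Real.log 2 + Real.log π * (-(σ / 2))) := by
    rw [Real.exp_add, Real.exp_sub, Real.rpow_def_of_pos Real.pi_pos, Real.exp_log two_pos,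
      show (2 : ℝ) * Real.log r = Real.log (r ^ 2) by rw [Real.log_pow]; norm_num,
      Real.exp_log (by positivity)]
  have e5 : Real.log (r / 2) = Real.log r - Real.log 2 := Real.log_div hrpos.ne' two_ne_zero
  have e6 : Real.log (2 * π) = Real.log 2 + Real.log π := Real.log_mul two_ne_zero Real.pi_pos.ne'
  rw [e1, e2, e3, e4, e5, e6, ← Real.exp_add, ← Real.exp_add, ← Real.exp_add, ← Real.exp_add]
  congr 1
  ring

/-- `‖ξ(s)‖ = (‖s‖ ‖s−1‖/2) · π^{−Re s/2} · ‖Γ(s/2)‖ · ‖ζ(s)‖` for `Re s > 1`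
(`ξ(s) = ½ s(s−1) π^{−s/2} Γ(s/2) ζ(s)`). [folklore] -/
theorem norm_riemannXi_eq {s : ℂ} (hs : 1 < s.re) :
    ‖riemannXi s‖ =
      ‖s‖ * ‖s - 1‖ / 2 * π ^ (-(s.re / 2)) * ‖Complex.Gamma (s / 2)‖ * ‖riemannZeta s‖ := by
  have hs0 : s ≠ 0 := fun h ↦ by rw [h] at hs; simp at hs; linarith
  have hs1 : s ≠ 1 := fun h ↦ by rw [h] at hs; simp at hs
  have hG : Gammaℝ s ≠ 0 := Gammaℝ_ne_zero_of_re_pos (by linarith)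
  have hΛ : completedRiemannZeta s = Gammaℝ s * riemannZeta s := by
    rw [riemannZeta_def_of_ne_zero hs0]; field_simp
  rw [riemannXi_eq_mul_completedRiemannZeta hs0 hs1, hΛ, Gammaℝ_def, norm_mul, norm_mul, norm_mul,
    norm_div, norm_mul, Complex.norm_cpow_eq_rpow_re_of_pos Real.pi_pos]
  have hre : (-s / 2).re = -(s.re / 2) := by simp; ring
  have h2 : ‖(2 : ℂ)‖ = 2 := by simp
  rw [hre, h2]
  ring

/-! ### Lemma 3.3 (2) of Lagarias–Montague -/

/-- Stirling for `|Γ(s/2)|`, `s = σ + it`, `σ > 0`: with `r = ‖s‖`,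
`|log ‖Γ(s/2)‖ − ((σ/2 − ½) log(r/2) − (t/2) arctan(t/σ) − σ/2 + ½ log 2π)| ≤ (1/12)(4/r² + π/r)`
(`Literature.Analysis.SpecialFunctions.GammaStirling.abs_log_norm_Gamma_sub_le` at `w = s/2`,
`Arg(s/2) = arctan(t/σ)`). This is the
display "`|Γ(s/2)| = exp(σ/2 log|s/2| − t/2 arctan(t/σ) − σ/2 + ½ log 4π − ½ log|s| + O(1/|s|))`"
of the printed proof. [cite: LagariasMontague2011, proof of Lemma 3.3 (2)] -/
theorem abs_log_norm_Gamma_half_sub_le {σ : ℝ} (hσ : 0 < σ) (t : ℝ) :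
    |Real.log ‖Complex.Gamma (((σ : ℂ) + t * I) / 2)‖ -
        ((σ / 2 - 1 / 2) * Real.log (‖(σ : ℂ) + t * I‖ / 2) - (t / 2) * Real.arctan (t / σ) -
          σ / 2 + Real.log (2 * π) / 2)| ≤
      1 / 12 * (1 / (‖(σ : ℂ) + t * I‖ / 2) ^ 2 + π / (2 * (‖(σ : ℂ) + t * I‖ / 2))) := by
  set s : ℂ := (σ : ℂ) + t * I with hs_def
  have hsre : s.re = σ := by simp [hs_def]
  have hsim : s.im = t := by simp [hs_def]
  set w : ℂ := s / 2 with hw_def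
  have hwre : w.re = σ / 2 := by simp [hw_def, hsre]
  have hwim : w.im = t / 2 := by simp [hw_def, hsim]
  have hwnorm : ‖w‖ = ‖s‖ / 2 := by simp [hw_def]
  have hwarg : Complex.arg w = Real.arctan (t / σ) := by
    rw [hw_def, show s / 2 = ((1 / 2 : ℝ) : ℂ) * s by push_cast; ring,
      Complex.arg_real_mul s (by norm_num), arg_eq_arctan_of_re_pos (by rw [hsre]; exact hσ),
      hsre, hsim]
  have hwpos : 0 < w.re := by rw [hwre]; linarith
  have h := abs_log_norm_Gamma_sub_le hwpos
  rw [hwre, hwim, hwnorm, hwarg] at h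
  exact h

/-- The Stirling error at `w = s/2` in terms of `r = |s| ≥ 2`: `(1/12)(4/r² + π/r) ≤ 1/(2r)`.
[folklore] -/
lemma stirling_error_half_le {r : ℝ} (hr : 2 ≤ r) :
    1 / 12 * (1 / (r / 2) ^ 2 + π / (2 * (r / 2))) ≤ 1 / r / 2 := by
  have hrpos : 0 < r := by linarith
  have hπ : π ≤ 4 := Real.pi_le_four
  rw [show 1 / 12 * (1 / (r / 2) ^ 2 + π / (2 * (r / 2))) = (4 + π * r) / (12 * r ^ 2) by
    field_simp; ring]
  rw [show 1 / r / 2 = 1 / (2 * r) by ring, div_le_div_iff₀ (by positivity) (by positivity)]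
  nlinarith [mul_le_mul_of_nonneg_left hπ (sq_nonneg r), mul_le_mul_of_nonneg_left hr hrpos.le]

/-- Bookkeeping of the three factors `1 + O(1/|s|)`, `e^{O(1/|s|)}`, `1 + O(2^{−σ})`: if
`p, q ∈ [1 − a, 1 + a]`, `r ∈ [1 − 4b, 1 + 4b]` with `0 ≤ a ≤ ½`, `0 ≤ b ≤ ¼`, `p, q, r ≥ 0`, then
`1 − 8(a + b) ≤ pqr ≤ 1 + 8(a + b)`. [folklore] -/
lemma triple_product_bounds {p q r a b : ℝ} (ha0 : 0 ≤ a) (ha : a ≤ 1 / 2) (hb0 : 0 ≤ b)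
    (hb : b ≤ 1 / 4) (hp : 1 - a ≤ p ∧ p ≤ 1 + a) (hq : 1 - a ≤ q ∧ q ≤ 1 + a)
    (hr : 1 - 4 * b ≤ r ∧ r ≤ 1 + 4 * b) (hp0 : 0 ≤ p) (hq0 : 0 ≤ q) :
    1 - 8 * (a + b) ≤ p * q * r ∧ p * q * r ≤ 1 + 8 * (a + b) := by
  constructor
  · have hA : (1 - a) * (1 - a) ≤ p * q := mul_le_mul hp.1 hq.1 (by linarith) hp0
    have hB : (1 - a) * (1 - a) * (1 - 4 * b) ≤ p * q * r :=
      mul_le_mul hA hr.1 (by linarith) (mul_nonneg hp0 hq0)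
    refine le_trans ?_ hB
    nlinarith [mul_nonneg ha0 hb0, mul_nonneg (mul_nonneg ha0 ha0) hb0, mul_nonneg ha0 ha0]
  · have hA : p * q ≤ (1 + a) * (1 + a) := mul_le_mul hp.2 hq.2 hq0 (by linarith)
    have hB : p * q * r ≤ (1 + a) * (1 + a) * (1 + 4 * b) :=
      mul_le_mul hA hr.2 (by linarith [hr.1]) (by positivity)
    refine hB.trans ?_
    nlinarith [mul_nonneg ha0 hb0, mul_nonneg (mul_nonneg ha0 ha0) hb0, mul_nonneg ha0 ha0,
      mul_le_mul_of_nonneg_left ha ha0, mul_le_mul_of_nonneg_left hb ha0,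
      mul_le_mul_of_nonneg_left hb (mul_nonneg ha0 ha0)]

/-- **`|ξ(s)| = F(σ,t) · |1 − 1/s| · e^{θ} · |ζ(s)|`** for `s = σ + it`, `σ > 1`, where
`θ = log|Γ(s/2)| − (Stirling main term at s/2)` (`norm_riemannXi_eq`,
`LagariasMontague.sizeModel_eq_stirling`). [cite: LagariasMontague2011, proof of Lemma 3.3 (2)] -/
theorem norm_riemannXi_eq_sizeModel_mul {σ : ℝ} (hσ : 1 < σ) (t : ℝ) :
    ‖riemannXi ((σ : ℂ) + t * I)‖ =
      LagariasMontague.sizeModel σ t *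
        (‖1 - 1 / ((σ : ℂ) + t * I)‖ *
          Real.exp (Real.log ‖Complex.Gamma (((σ : ℂ) + t * I) / 2)‖ -
            ((σ / 2 - 1 / 2) * Real.log (‖(σ : ℂ) + t * I‖ / 2) - (t / 2) * Real.arctan (t / σ) -
              σ / 2 + Real.log (2 * π) / 2)) *
          ‖riemannZeta ((σ : ℂ) + t * I)‖) := by
  set s : ℂ := (σ : ℂ) + t * I with hs_def
  have hsre : s.re = σ := by simp [hs_def]
  have hσ0 : 0 < σ := by linarith
  have hs0 : s ≠ 0 := by
    intro h; have := congrArg Complex.re h; rw [hsre] at this; simp at this; linarith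
  set M : ℝ := (σ / 2 - 1 / 2) * Real.log (‖s‖ / 2) - (t / 2) * Real.arctan (t / σ) - σ / 2 +
    Real.log (2 * π) / 2 with hM
  have hΓw : Complex.Gamma (s / 2) ≠ 0 :=
    Complex.Gamma_ne_zero_of_re_pos (by simp [hsre]; linarith)
  have hΓexp : Real.exp (Real.log ‖Complex.Gamma (s / 2)‖ - M) =
      ‖Complex.Gamma (s / 2)‖ / Real.exp M := by
    rw [Real.exp_sub, Real.exp_log (norm_pos_iff.2 hΓw)]
  have hF : LagariasMontague.sizeModel σ t = ‖s‖ ^ 2 / 2 * π ^ (-(σ / 2)) * Real.exp M :=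
    sizeModel_eq_stirling hσ0 t
  have hs1 : ‖s - 1‖ = ‖s‖ * ‖1 - 1 / s‖ := by
    rw [← norm_mul]; congr 1; field_simp
  rw [norm_riemannXi_eq (by rw [hsre]; exact hσ), hs1, hsre, hF, hΓexp]
  have hE : Real.exp M ≠ 0 := (Real.exp_pos M).ne'
  field_simp

end LagariasMontague

/-- **Lagarias–Montague 2011, Lemma 3.3 (2)** (discharge of the named fact
`norm_riemannXi_two_sided_LM`, with `C₂ = C₃ = 8`): for `σ ≥ 2` and all real `t`,
`F(σ,t)(1 − 8(1/|σ+it| + 2^{−σ})) ≤ |ξ(σ+it)| ≤ F(σ,t)(1 + 8(1/|σ+it| + 2^{−σ}))`.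
Printed proof (p. 9): `|s(s−1)| = |s|²(1 + O(1/|s|))`, `|ζ(s)| = 1 + O(2^{−σ})`
(`SelbergMollifier.norm_riemannZeta_sub_one_le`), `|π^{−s/2}| = π^{−σ/2}`, and Stirling
`|Γ(s/2)| = exp(Re[(s/2) log(s/2) − s/2 + ½ log(4π/s)] + O(1/|s|))`
(`abs_log_norm_Gamma_half_sub_le`, error `≤ 1/(2|s|)` here), combined
(`norm_riemannXi_eq_sizeModel_mul`, `triple_product_bounds`).
[cite: LagariasMontague2011, Lemma 3.3 (2)] -/
theorem norm_riemannXi_two_sided_LM_holds : norm_riemannXi_two_sided_LM := by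
  refine ⟨8, 8, by norm_num, by norm_num, fun σ t hσ ↦ ?_⟩
  have hσ0 : 0 < σ := by linarith
  have hns : σ ≤ ‖(σ : ℂ) + t * I‖ := by
    have := Complex.abs_re_le_norm ((σ : ℂ) + t * I)
    simp only [Complex.add_re, Complex.ofReal_re, Complex.mul_re, Complex.I_re, mul_zero,
      Complex.ofReal_im, Complex.I_im, mul_one, sub_self, add_zero, abs_of_pos hσ0] at this
    exact this
  have hs2 : 2 ≤ ‖(σ : ℂ) + t * I‖ := hσ.trans hns
  have hspos : 0 < ‖(σ : ℂ) + t * I‖ := by linarith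
  -- the two small parameters
  have ha0 : 0 ≤ 1 / ‖(σ : ℂ) + t * I‖ := by positivity
  have ha2 : 1 / ‖(σ : ℂ) + t * I‖ ≤ 1 / 2 := one_div_le_one_div_of_le two_pos hs2
  have hb0 : 0 ≤ (2 : ℝ) ^ (-σ) := (Real.rpow_pos_of_pos two_pos _).le
  have hb4 : (2 : ℝ) ^ (-σ) ≤ 1 / 4 := by
    have : (2 : ℝ) ^ (-σ) ≤ 2 ^ (-(2 : ℝ)) :=
      Real.rpow_le_rpow_of_exponent_le one_le_two (by linarith)
    refine this.trans_eq ?_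
    rw [Real.rpow_neg zero_le_two, Real.rpow_two]
    norm_num
  -- the three factors
  have h1 : 1 - 1 / ‖(σ : ℂ) + t * I‖ ≤ ‖1 - 1 / ((σ : ℂ) + t * I)‖ ∧
      ‖1 - 1 / ((σ : ℂ) + t * I)‖ ≤ 1 + 1 / ‖(σ : ℂ) + t * I‖ := by
    have e : ‖(1 : ℂ) / ((σ : ℂ) + t * I)‖ = 1 / ‖(σ : ℂ) + t * I‖ := by rw [norm_div, norm_one]
    constructor
    · have := norm_sub_norm_le (1 : ℂ) (1 / ((σ : ℂ) + t * I))
      rwa [norm_one, e] at this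
    · have := norm_sub_le (1 : ℂ) (1 / ((σ : ℂ) + t * I))
      rwa [norm_one, e] at this
  have hθ : |Real.log ‖Complex.Gamma (((σ : ℂ) + t * I) / 2)‖ -
      ((σ / 2 - 1 / 2) * Real.log (‖(σ : ℂ) + t * I‖ / 2) - (t / 2) * Real.arctan (t / σ) -
        σ / 2 + Real.log (2 * π) / 2)| ≤ 1 / ‖(σ : ℂ) + t * I‖ / 2 :=
    (LagariasMontague.abs_log_norm_Gamma_half_sub_le hσ0 t).trans
      (LagariasMontague.stirling_error_half_le hs2)
  have h2 : 1 - 1 / ‖(σ : ℂ) + t * I‖ ≤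
      Real.exp (Real.log ‖Complex.Gamma (((σ : ℂ) + t * I) / 2)‖ -
        ((σ / 2 - 1 / 2) * Real.log (‖(σ : ℂ) + t * I‖ / 2) - (t / 2) * Real.arctan (t / σ) -
          σ / 2 + Real.log (2 * π) / 2)) ∧
      Real.exp (Real.log ‖Complex.Gamma (((σ : ℂ) + t * I) / 2)‖ -
        ((σ / 2 - 1 / 2) * Real.log (‖(σ : ℂ) + t * I‖ / 2) - (t / 2) * Real.arctan (t / σ) -
          σ / 2 + Real.log (2 * π) / 2)) ≤ 1 + 1 / ‖(σ : ℂ) + t * I‖ := by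
    have h := Real.abs_exp_sub_one_le (hθ.trans (by linarith))
    have h' := h.trans (show 2 * _ ≤ 1 / ‖(σ : ℂ) + t * I‖ from by linarith)
    constructor <;> linarith [(abs_le.1 h').1, (abs_le.1 h').2]
  have h3 : 1 - 4 * (2 : ℝ) ^ (-σ) ≤ ‖riemannZeta ((σ : ℂ) + t * I)‖ ∧
      ‖riemannZeta ((σ : ℂ) + t * I)‖ ≤ 1 + 4 * (2 : ℝ) ^ (-σ) := by
    have h := norm_riemannZeta_sub_one_le (s := (σ : ℂ) + t * I) (by simp; exact hσ)
    have hre : ((σ : ℂ) + t * I).re = σ := by simp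
    rw [hre] at h
    have h' : |‖riemannZeta ((σ : ℂ) + t * I)‖ - 1| ≤ 4 * (2 : ℝ) ^ (-σ) := by
      have := abs_norm_sub_norm_le (riemannZeta ((σ : ℂ) + t * I)) 1
      rw [norm_one] at this
      exact this.trans h
    constructor <;> linarith [(abs_le.1 h').1, (abs_le.1 h').2]
  have hprod := LagariasMontague.triple_product_bounds ha0 ha2 hb0 hb4 h1 h2 h3 (norm_nonneg _)
    (Real.exp_pos _).le
  have hFpos : 0 < LagariasMontague.sizeModel σ t := by
    unfold LagariasMontague.sizeModel
    have h1' : 0 < (2 * π * Real.exp 1) ^ (-(σ / 2)) := Real.rpow_pos_of_pos (by positivity) _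
    have h2' : 0 < (σ ^ 2 + t ^ 2) ^ ((σ + 3) / 4) := Real.rpow_pos_of_pos (by positivity) _
    have h3' : 0 < Real.sqrt π := Real.sqrt_pos.2 Real.pi_pos
    positivity
  rw [LagariasMontague.norm_riemannXi_eq_sizeModel_mul (by linarith) t]
  exact ⟨mul_le_mul_of_nonneg_left hprod.1 hFpos.le, mul_le_mul_of_nonneg_left hprod.2 hFpos.le⟩

end Literature.NumberTheory.LFunctions
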